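import Summits.ValiantsHypothesis.ValiantsHypothesis.Theorems.MatrixDescartes.Negative.MatrixDescartesFalseOfTropicalMonster
import Summits.ValiantsHypothesis.ValiantsHypothesis.Theorems.KPlusLogSqLawTropicalShiftThreeChain
import Summits.ValiantsHypothesis.ValiantsHypothesis.Theorems.KPlusLogSqLawTropicalBCyclePotential
import Summits.ValiantsHypothesis.ValiantsHypothesis.Theorems.LacunarySymmetroidMatrixDescartesCensusTropicalKLawStatic

/-!
# Route «KPlusLogSqLaw», crux `TropicalB` (stmt-ValiantsHypothesis-19771) — the AFFINE-DUAL SECTOR LAW: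
# a dominant chain certified column-wise by row potentials AFFINE in the slope has `n + m ≤ K·m²`

HONEST FRAMING.  Helper (`--supports stmt-ValiantsHypothesis-19771`, def-free) toward the registered stubs `stub_tropThin` /
`stub_tropFat` / `stub_tropTowerLog` of `Cruxes/TropicalB/Lines/birth.lean` (crux
`Summit.ValiantsHypothesis.ValiantsHypothesis.Theses.KPlusLogSqLaw.TropicalB`) and the `K = 4` growth fork of the lifting cruxes
(`…KPlusLogSqLaw.Lifting`, stmt-ValiantsHypothesis-19772: `stub_liftThin`; `…KPlusLogSqLaw.WeakLifting`, stmt-ValiantsHypothesis-19561).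
A SECTOR theorem about dominant chains of ARBITRARY dominance designs (any support, valuations, exponents, any `m, K`) under a
CERTIFICATE-CLASS hypothesis; it bounds nothing for `TropicalB` in its window and asserts nothing about `TropicalB`, `Lifting`,
`WeakLifting`, `KPlusLogSqLaw`, `MatrixDescartes` (stmt-ValiantsHypothesis-18050) or `VP ≠ VNP`.

THE LAW.  Let `(d, v, ε)` be a design of format `(m, K)` and `p₀, …, pₙ` terms, `pₖ = (σₖ, λₖ)` the unique optimum (`IsDominant`) at the
integer slope `θₖ`, `θ` strictly increasing, consecutive terms distinct (e.g. sign-alternating).  By LP duality every single `pₖ` has a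
dual certificate at `θₖ` (row/column potentials tight on `pₖ`, slack elsewhere; the tree's `TropicalCensus.isDominant_of_scaledPotential`).
Call the chain AFFINELY CERTIFIED (scale `S > 0`, row gauge `x`, row potential `y : Fin m → ℤ`) if ONE choice of row potentials
AFFINE IN THE SLOPE, `uₐ(θ) = θ·xₐ − yₐ` (column potentials free at every `θₖ`), certifies every `pₖ` column by column: for every `k`,
every column `b` and every PRESENT incidence `(a, b, l)`,
  `S·(θₖ·d l − v a b l) + (θₖ·xₐ − yₐ) ≤ S·(θₖ·d (λₖ b) − v (σₖ b) b (λₖ b)) + (θₖ·x_{σₖ b} − y_{σₖ b})`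
(the incidence of `pₖ` in column `b` maximises the gauged score of its column).  Then:

* `gaugedSlope_mono` — in every column the GAUGED SLOPE `S·d (λₖ b) + x (σₖ b)` of the certified incidence is non-decreasing in `k`
  (two certificate inequalities at `θₖ` and `θₖ₊₁` sandwich the intercept difference between `θₖ·Δ` and `θₖ₊₁·Δ`);
* `exists_gaugedSlope_lt` — at every step SOME column's gauged slope rises strictly (otherwise all column score lines of `pₖ₊₁` and `pₖ`
  coincide, and summing them — the gauge `∑_b (θ x_{σ b} − y_{σ b})` is the same for every permutation — gives equal tropical weights at
  `θₖ`, against unique optimality);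
* `chain_le_of_affineCert_card` — **`n + m ≤ m · #T`** for any finite set `T ∋` all gauged slopes `S·d l + x a` (per column a
  non-decreasing `T`-valued sequence rises strictly at most `#T − 1` times; every step is paid by some column);
* `chain_le_of_affineCert` — **`n + m ≤ K·m²`** (`T` = the `≤ m·K` values `S·d l + x a`), and `chain_le_of_affineCert_alt` (sign-alternating
  form, the hypothesis list of `TropicalCensus.TropRootLawAt`); `chain_le_of_columnCert` — with the TRIVIAL gauge `x = 0` (every certified
  incidence is outright the best of its column at its slope, any permutations): **`n + m ≤ K·m`**, i.e. `n ≤ m(K − 1)`, which contains the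
  tree's column-diagonally-dominant law `diagDominant_chain_le` (`…TropicalBDiagonalDominant`, permutation frozen to `1`) as the case where
  the certified rows happen to be the diagonal.

WHY IT IS RECORDED (located reading, nothing asserted).  (1) The sector is inhabited by the route's model super-linear family: SHIFT-THREE
(`…TropicalShiftThree`, the counting-tight `K = 3` row `C(m+2,2) − 1`) is proved dominant exactly this way — its per-entry score
`phi = θ·d l − v + θ(2m+3)·shiftZ(a,b) − θ·D·[a<b] = θ·d l − v + θ(2m+3)(a − b)` (`D = m(2m+3)`) is the affine row gauge `xₐ = (2m+3)·a`,
`y = 0`, `S = 1`, and `phi_le`/`phi_lt` is the column-wise certificate; the law caps that whole certificate class at `K·m² − m`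
(`= 3m² − m` at `K = 3`, against SHIFT-THREE's `≈ m²/2`).  (2) Consequently every fixed-`K` family with MORE than `K·m² − m` alternations —
in particular any CUBIC `(m, 4)` family (the open `K = 4` fork: `TropK4Law 2` versus the rung `stub_liftThin` at `K = 4`, files
`…LiftingRungFourRealSide`, `…LiftingRungFourRange*`), and a fortiori any family threatening `stub_tropTowerLog` / `TropicalB` — needs dual
row potentials that BEND along the chain: if the potentials are affine on each of `P` consecutive sub-chains the bound is `P·K·m²`, so a
cubic `K = 4` family needs `Ω(m)` affine pieces and a `2^{CK}`-chain at `m = K⌊log₂K⌋` needs `2^{CK}/(K³ log₂²K)` pieces.  Phase-wise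
affine certificates (one gauge per phase, as in rotation-phase designs) are thus priced: the number of phases, not the work inside a
phase, must carry the growth.  [folklore: LP duality for the assignment polytope; the counting is elementary]
-/

set_option linter.dupNamespace false
set_option autoImplicit false

namespace Summit.ValiantsHypothesis.ValiantsHypothesis.Theorems.KPlusLogSqLaw

open Summit.ValiantsHypothesis.ValiantsHypothesis.Theorems.MatrixDescartes.Negative
open Summit.ValiantsHypothesis.ValiantsHypothesis.Theorems.LacunarySymmetroidMatrixDescartes.TropicalCensus (present_of_termSign_ne_zero)
open scoped BigOperators
open Finset

namespace AffineDual

variable {m K : ℕ} (d : Fin K → ℕ) (v ε : Fin m → Fin m → Fin K → ℤ)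

/-- the gauged column scores of a term sum to `S·(tropical weight) + (a permutation-invariant gauge sum)`. [folklore] -/
theorem sum_gaugedScore (S : ℤ) (x y : Fin m → ℤ) (θ : ℤ) (q : Equiv.Perm (Fin m) × (Fin m → Fin K)) :
    ∑ b, (S * (θ * (d (q.2 b) : ℤ) - v (q.1 b) b (q.2 b)) + (θ * x (q.1 b) - y (q.1 b))) =
      S * tropWeight d v θ q + ∑ a, (θ * x a - y a) := by
  rw [sum_add_distrib, Equiv.sum_comp q.1 (fun a => θ * x a - y a)]
  congr 1
  unfold tropWeight
  rw [← mul_sum, sum_sub_distrib, mul_sum]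

section Chain

variable (S : ℤ) (x y : Fin m → ℤ) {n : ℕ} (θ : Fin (n + 1) → ℤ)
  (p : Fin (n + 1) → Equiv.Perm (Fin m) × (Fin m → Fin K))

/-- **Gauged slopes are monotone along an affinely certified chain.**  If the incidences of `pₖ` and `pₖ₊₁` in column `b` each maximise the
gauged column score at their own slope (the two certificate inequalities, one at `θₖ` against `pₖ₊₁`'s incidence and one at `θₖ₊₁` against
`pₖ`'s), then the gauged slope `S·d + x` does not decrease from `k` to `k + 1`. [folklore] -/
theorem gaugedSlope_mono (hθ : StrictMono θ) (k : Fin n) (b : Fin m)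
    (h₁ : S * (θ k.castSucc * (d ((p k.succ).2 b) : ℤ) - v ((p k.succ).1 b) b ((p k.succ).2 b)) +
        (θ k.castSucc * x ((p k.succ).1 b) - y ((p k.succ).1 b)) ≤
      S * (θ k.castSucc * (d ((p k.castSucc).2 b) : ℤ) - v ((p k.castSucc).1 b) b ((p k.castSucc).2 b)) +
        (θ k.castSucc * x ((p k.castSucc).1 b) - y ((p k.castSucc).1 b)))
    (h₂ : S * (θ k.succ * (d ((p k.castSucc).2 b) : ℤ) - v ((p k.castSucc).1 b) b ((p k.castSucc).2 b)) +
        (θ k.succ * x ((p k.castSucc).1 b) - y ((p k.castSucc).1 b)) ≤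
      S * (θ k.succ * (d ((p k.succ).2 b) : ℤ) - v ((p k.succ).1 b) b ((p k.succ).2 b)) +
        (θ k.succ * x ((p k.succ).1 b) - y ((p k.succ).1 b))) :
    S * (d ((p k.castSucc).2 b) : ℤ) + x ((p k.castSucc).1 b) ≤ S * (d ((p k.succ).2 b) : ℤ) + x ((p k.succ).1 b) := by
  have hlt : θ k.castSucc < θ k.succ := hθ Fin.castSucc_lt_succ
  set s₀ := S * (d ((p k.castSucc).2 b) : ℤ) + x ((p k.castSucc).1 b) with hs₀
  set s₁ := S * (d ((p k.succ).2 b) : ℤ) + x ((p k.succ).1 b) with hs₁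
  set c₀ := S * v ((p k.castSucc).1 b) b ((p k.castSucc).2 b) + y ((p k.castSucc).1 b) with hc₀
  set c₁ := S * v ((p k.succ).1 b) b ((p k.succ).2 b) + y ((p k.succ).1 b) with hc₁
  have e₁ : θ k.castSucc * (s₁ - s₀) ≤ c₁ - c₀ := by
    rw [hs₀, hs₁, hc₀, hc₁]; linear_combination h₁
  have e₂ : c₁ - c₀ ≤ θ k.succ * (s₁ - s₀) := by
    rw [hs₀, hs₁, hc₀, hc₁]; linear_combination h₂
  by_contra hlt'
  have hneg : s₁ - s₀ < 0 := by linarith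
  have := mul_lt_mul_of_neg_right hlt hneg
  linarith

variable (hS : 0 < S) (hθ : StrictMono θ) (hdom : ∀ k, IsDominant d v ε (θ k) (p k))
  (hne : ∀ k : Fin n, p k.castSucc ≠ p k.succ)
  (hcert : ∀ (k : Fin (n + 1)) (b a : Fin m) (l : Fin K), ε a b l ≠ 0 →
    S * (θ k * (d l : ℤ) - v a b l) + (θ k * x a - y a) ≤
      S * (θ k * (d ((p k).2 b) : ℤ) - v ((p k).1 b) b ((p k).2 b)) + (θ k * x ((p k).1 b) - y ((p k).1 b)))
include hS hθ hdom hne hcert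

omit hS hne in
/-- monotonicity of the certified gauged slope in every column, from the certificate. -/
theorem gaugedSlope_le (k : Fin n) (b : Fin m) :
    S * (d ((p k.castSucc).2 b) : ℤ) + x ((p k.castSucc).1 b) ≤ S * (d ((p k.succ).2 b) : ℤ) + x ((p k.succ).1 b) :=
  gaugedSlope_mono d v S x y θ p hθ k b
    (hcert k.castSucc b _ _ (present_of_termSign_ne_zero ε _ (hdom k.succ).1 b))
    (hcert k.succ b _ _ (present_of_termSign_ne_zero ε _ (hdom k.castSucc).1 b))

/-- **At every step some column's gauged slope rises strictly.**  Otherwise every column score line of `pₖ₊₁` coincides with that of `pₖ`;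
summing (`sum_gaugedScore`: the gauge part is permutation-invariant) gives equal tropical weights at `θₖ`, contradicting the unique
optimality of `pₖ` there (`pₖ₊₁ ≠ pₖ` is present). [folklore] -/
theorem exists_gaugedSlope_lt (k : Fin n) :
    ∃ b : Fin m, S * (d ((p k.castSucc).2 b) : ℤ) + x ((p k.castSucc).1 b) < S * (d ((p k.succ).2 b) : ℤ) + x ((p k.succ).1 b) := by
  by_contra hno
  simp only [not_exists, not_lt] at hno
  have hlt : θ k.castSucc < θ k.succ := hθ Fin.castSucc_lt_succ
  -- every column: equal slope, hence (sandwich) equal intercept, hence equal score at `θₖ`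
  have hcol : ∀ b : Fin m,
      S * (θ k.castSucc * (d ((p k.succ).2 b) : ℤ) - v ((p k.succ).1 b) b ((p k.succ).2 b)) +
          (θ k.castSucc * x ((p k.succ).1 b) - y ((p k.succ).1 b)) =
        S * (θ k.castSucc * (d ((p k.castSucc).2 b) : ℤ) - v ((p k.castSucc).1 b) b ((p k.castSucc).2 b)) +
          (θ k.castSucc * x ((p k.castSucc).1 b) - y ((p k.castSucc).1 b)) := by
    intro b
    have hle := gaugedSlope_le d v ε S x y θ p hθ hdom hcert k b
    have heq : S * (d ((p k.castSucc).2 b) : ℤ) + x ((p k.castSucc).1 b) =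
        S * (d ((p k.succ).2 b) : ℤ) + x ((p k.succ).1 b) := le_antisymm hle (hno b)
    have h₁ := hcert k.castSucc b _ _ (present_of_termSign_ne_zero ε _ (hdom k.succ).1 b)
    have h₂ := hcert k.succ b _ _ (present_of_termSign_ne_zero ε _ (hdom k.castSucc).1 b)
    -- with equal slopes the two inequalities force equal intercepts
    have e₁ : S * v ((p k.castSucc).1 b) b ((p k.castSucc).2 b) + y ((p k.castSucc).1 b) ≤
        S * v ((p k.succ).1 b) b ((p k.succ).2 b) + y ((p k.succ).1 b) := by
      linear_combination h₁ + θ k.castSucc * heq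
    have e₂ : S * v ((p k.succ).1 b) b ((p k.succ).2 b) + y ((p k.succ).1 b) ≤
        S * v ((p k.castSucc).1 b) b ((p k.castSucc).2 b) + y ((p k.castSucc).1 b) := by
      linear_combination h₂ - θ k.succ * heq
    linear_combination (-θ k.castSucc) * heq + (le_antisymm e₁ e₂)
  have hsum := Finset.sum_congr rfl fun b (_ : b ∈ (univ : Finset (Fin m))) => hcol b
  rw [sum_gaugedScore d v S x y, sum_gaugedScore d v S x y] at hsum
  have hw : tropWeight d v (θ k.castSucc) (p k.succ) < tropWeight d v (θ k.castSucc) (p k.castSucc) :=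
    (hdom k.castSucc).2 _ (hne k).symm (hdom k.succ).1
  have : S * tropWeight d v (θ k.castSucc) (p k.succ) < S * tropWeight d v (θ k.castSucc) (p k.castSucc) :=
    mul_lt_mul_of_pos_left hw hS
  linarith

/-- **THE AFFINE-DUAL SECTOR LAW (cardinality form): `n + m ≤ m · #T`** for every finite `T` containing all gauged slopes `S·d l + x a`.
Per column the certified gauged slope is a non-decreasing `T`-valued sequence, so it rises strictly at most `#T − 1` times; every step is paid
by some column. [folklore] -/
theorem chain_le_of_affineCert_card (T : Finset ℤ) (hT : ∀ (a : Fin m) (l : Fin K), S * (d l : ℤ) + x a ∈ T) :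
    n + m ≤ m * T.card := by
  classical
  -- the gauged slope of column `b` at step `k`
  set f : Fin m → Fin (n + 1) → ℤ := fun b k => S * (d ((p k).2 b) : ℤ) + x ((p k).1 b) with hf
  have hmono : ∀ b, Monotone (f b) := fun b =>
    Fin.monotone_iff_le_succ.mpr fun k => gaugedSlope_le d v ε S x y θ p hθ hdom hcert k b
  have hmem : ∀ b k, f b k ∈ T := fun b k => hT _ _
  -- strict rises of column `b`
  set N : Fin m → ℕ := fun b => (univ.filter fun k : Fin n => f b k.castSucc < f b k.succ).card with hN
  -- (a) every step is paid by some column: `n ≤ ∑_b N b`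
  have ha : n ≤ ∑ b, N b := by
    have h1 : ∑ b, N b = ∑ k : Fin n, ∑ b : Fin m, (if f b k.castSucc < f b k.succ then 1 else 0) := by
      rw [sum_comm]
      refine sum_congr rfl fun b _ => ?_
      rw [hN]
      exact card_filter _ _
    rw [h1]
    have h2 : ∀ k : Fin n, 1 ≤ ∑ b : Fin m, (if f b k.castSucc < f b k.succ then 1 else 0) := by
      intro k
      obtain ⟨b, hb⟩ := exists_gaugedSlope_lt d v ε S x y θ p hS hθ hdom hne hcert k
      have hb' : f b k.castSucc < f b k.succ := hb
      calc (1 : ℕ) = (if f b k.castSucc < f b k.succ then 1 else 0) := by rw [if_pos hb']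
        _ ≤ ∑ b : Fin m, (if f b k.castSucc < f b k.succ then 1 else 0) :=
          single_le_sum (f := fun b' : Fin m => if f b' k.castSucc < f b' k.succ then 1 else 0)
            (fun _ _ => Nat.zero_le _) (mem_univ b)
    calc n = ∑ _k : Fin n, (1 : ℕ) := by simp
      _ ≤ _ := sum_le_sum fun k _ => h2 k
  -- (b) per column: `N b + 1 ≤ #T`
  have hb : ∀ b, N b + 1 ≤ T.card := by
    intro b
    have h0 : f b 0 ∈ T := hmem b 0
    have hcard : (T.erase (f b 0)).card = T.card - 1 := card_erase_of_mem h0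
    have hpos : 1 ≤ T.card := card_pos.mpr ⟨_, h0⟩
    have hle : N b ≤ (T.erase (f b 0)).card := by
      rw [hN]
      refine card_le_card_of_injOn (fun k : Fin n => f b k.succ) (fun k hk => ?_) (fun k hk k' hk' hkk' => ?_)
      · have hks : f b k.castSucc < f b k.succ := (mem_filter.mp (mem_coe.mp hk)).2
        have h0k : f b 0 ≤ f b k.castSucc := hmono b (Fin.zero_le _)
        have hne0 : f b k.succ ≠ f b 0 := by
          intro h
          rw [h] at hks
          exact absurd hks (not_lt.mpr h0k)
        exact mem_coe.mpr (mem_erase.mpr ⟨hne0, hmem b _⟩)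
      · have e : f b k.succ = f b k'.succ := hkk'
        have hks : f b k.castSucc < f b k.succ := (mem_filter.mp (mem_coe.mp hk)).2
        have hks' : f b k'.castSucc < f b k'.succ := (mem_filter.mp (mem_coe.mp hk')).2
        by_contra hne'
        rcases lt_or_gt_of_ne hne' with hlt | hlt
        · have hv : (k : ℕ) < (k' : ℕ) := Fin.lt_def.mp hlt
          have h1 : f b k.succ ≤ f b k'.castSucc := hmono b (by
            rw [Fin.le_iff_val_le_val]; simp only [Fin.val_succ, Fin.val_castSucc]; omega)
          exact absurd e (ne_of_lt (lt_of_le_of_lt h1 hks'))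
        · have hv : (k' : ℕ) < (k : ℕ) := Fin.lt_def.mp hlt
          have h1 : f b k'.succ ≤ f b k.castSucc := hmono b (by
            rw [Fin.le_iff_val_le_val]; simp only [Fin.val_succ, Fin.val_castSucc]; omega)
          exact absurd e.symm (ne_of_lt (lt_of_le_of_lt h1 hks))
    omega
  -- (c) sum up
  have hc : ∑ b : Fin m, (N b + 1) ≤ ∑ _b : Fin m, T.card := sum_le_sum fun b _ => hb b
  rw [sum_add_distrib] at hc
  simp only [sum_const, card_univ, Fintype.card_fin, smul_eq_mul, mul_one] at hc
  omega

/-- **THE AFFINE-DUAL SECTOR LAW: `n + m ≤ K·m²`.**  A chain of unique optima at strictly increasing integer slopes with distinct consecutive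
terms, certified column by column by row potentials affine in the slope (scale `S > 0`, gauge `x`, potential `y`), has at most `K·m² − m`
steps — whatever the design. [folklore] -/
theorem chain_le_of_affineCert : n + m ≤ K * m ^ 2 := by
  classical
  have h := chain_le_of_affineCert_card d v ε S x y θ p hS hθ hdom hne hcert
    ((univ : Finset (Fin m × Fin K)).image fun al => S * (d al.2 : ℤ) + x al.1)
    (fun a l => mem_image.mpr ⟨(a, l), mem_univ _, rfl⟩)
  have hcard : ((univ : Finset (Fin m × Fin K)).image fun al => S * (d al.2 : ℤ) + x al.1).card ≤ m * K :=
    card_image_le.trans (by simp)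
  calc n + m ≤ m * ((univ : Finset (Fin m × Fin K)).image fun al => S * (d al.2 : ℤ) + x al.1).card := h
    _ ≤ m * (m * K) := Nat.mul_le_mul_left _ hcard
    _ = K * m ^ 2 := by ring

end Chain

section Corollaries

variable (S : ℤ) (x y : Fin m → ℤ) {n : ℕ} (θ : Fin (n + 1) → ℤ)
  (p : Fin (n + 1) → Equiv.Perm (Fin m) × (Fin m → Fin K))

/-- **Sign-alternating form** (the hypothesis list of `TropicalCensus.TropRootLawAt`): an affinely certified sign-alternating dominant chain
has `n + m ≤ K·m²`. [folklore] -/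
theorem chain_le_of_affineCert_alt (hS : 0 < S) (hθ : StrictMono θ) (hdom : ∀ k, IsDominant d v ε (θ k) (p k))
    (halt : ∀ k : Fin n, termSign ε (p k.castSucc) * termSign ε (p k.succ) < 0)
    (hcert : ∀ (k : Fin (n + 1)) (b a : Fin m) (l : Fin K), ε a b l ≠ 0 →
      S * (θ k * (d l : ℤ) - v a b l) + (θ k * x a - y a) ≤
        S * (θ k * (d ((p k).2 b) : ℤ) - v ((p k).1 b) b ((p k).2 b)) + (θ k * x ((p k).1 b) - y ((p k).1 b))) :
    n + m ≤ K * m ^ 2 :=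
  chain_le_of_affineCert d v ε S x y θ p hS hθ hdom (CyclePotential.ne_of_alt ε p halt) hcert

/-- **Trivial gauge (`x = 0`): `n + m ≤ K·m`, i.e. `n ≤ m(K − 1)`.**  If at every slope of the chain every incidence of the dominant term is
outright the best present incidence OF ITS COLUMN (scaled score `S(θ·d l − v) − yₐ` with a slope-free row potential `y`), the permutations
being arbitrary, then the chain has at most `m(K − 1)` steps: per column the class exponent `d` itself is monotone.  Contains the
column-diagonally-dominant law (`…TropicalBDiagonalDominant.diagDominant_chain_le`, permutation frozen to `1`). [folklore] -/
theorem chain_le_of_columnCert (hS : 0 < S) (hθ : StrictMono θ) (hdom : ∀ k, IsDominant d v ε (θ k) (p k))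
    (hne : ∀ k : Fin n, p k.castSucc ≠ p k.succ)
    (hcert : ∀ (k : Fin (n + 1)) (b a : Fin m) (l : Fin K), ε a b l ≠ 0 →
      S * (θ k * (d l : ℤ) - v a b l) - y a ≤ S * (θ k * (d ((p k).2 b) : ℤ) - v ((p k).1 b) b ((p k).2 b)) - y ((p k).1 b)) :
    n + m ≤ K * m := by
  classical
  have hcert' : ∀ (k : Fin (n + 1)) (b a : Fin m) (l : Fin K), ε a b l ≠ 0 →
      S * (θ k * (d l : ℤ) - v a b l) + (θ k * (0 : Fin m → ℤ) a - y a) ≤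
        S * (θ k * (d ((p k).2 b) : ℤ) - v ((p k).1 b) b ((p k).2 b)) +
          (θ k * (0 : Fin m → ℤ) ((p k).1 b) - y ((p k).1 b)) := by
    intro k b a l h
    simp only [Pi.zero_apply, mul_zero, zero_sub]
    linarith [hcert k b a l h]
  have h := chain_le_of_affineCert_card d v ε S 0 y θ p hS hθ hdom hne hcert'
    ((univ : Finset (Fin K)).image fun l => S * (d l : ℤ))
    (fun a l => mem_image.mpr ⟨l, mem_univ _, by simp⟩)
  have hcard : ((univ : Finset (Fin K)).image fun l => S * (d l : ℤ)).card ≤ K := card_image_le.trans (by simp)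
  calc n + m ≤ m * ((univ : Finset (Fin K)).image fun l => S * (d l : ℤ)).card := h
    _ ≤ m * K := Nat.mul_le_mul_left _ hcard
    _ = K * m := Nat.mul_comm _ _

end Corollaries

section ShiftThreeInstance

/-! ### The sector is inhabited by the route's model family: SHIFT-THREE is affinely certified

The tree's counting-tight `K = 3` family SHIFT-THREE (`…TropicalShiftThree{Defs,,Chain}`, format `(r+1, 3)`, `C(r+3,2) − 1` sign-alternating
unique optima) is proved dominant through the per-entry score `ShiftThree.phi`; that score IS an affine row gauge: `phi θ a b l =
(θ·d l − v a b l) + θ·(2r+5)·a − θ·(2r+5)·b` (`shiftThree_phi_eq`), and `ShiftThree.phi_le` is literally the column-wise certificate with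
`S = 1`, `x a = (2r+5)·a`, `y = 0` (`shiftThree_affineCert`).  Hence the law applies to it (`shiftThree_chain_le`: its `C(r+3,2) − 2` steps
`+ (r+1)` are `≤ 3(r+1)²`) — numerically trivial, recorded to certify in the kernel that the hypothesis class of `chain_le_of_affineCert` is
exactly the certificate type of the tree's model construction, so that the contrapositive («more than `K·m² − m` steps ⇒ the row potentials
bend») is a statement about real designs. -/

open Summit.ValiantsHypothesis.ValiantsHypothesis.Theorems.LacunarySymmetroidMatrixDescartes.TropicalCensus

/-- SHIFT-THREE's per-entry score is the affine row gauge `x a = (2r+5)·a` minus the (column-constant) term `θ(2r+5)·b`: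
`(2r+5)·shiftZ a b − D·[a<b] = (2r+5)(a − b)` since `D = (r+1)(2r+5)`. -/
theorem shiftThree_phi_eq (r : ℕ) (θ : ℤ) (a b : Fin (r + 1)) (l : Fin 3) :
    ShiftThree.phi r θ a b l =
      (θ * (ShiftThree.dd r l : ℤ) - ShiftThree.vv r a b l) + θ * ((2 * r + 5) * (a : ℤ)) - θ * ((2 * r + 5) * (b : ℤ)) := by
  unfold ShiftThree.phi ShiftThree.shiftZ ShiftThree.bigD
  split_ifs with h <;> push_cast <;> ring

/-- **SHIFT-THREE is affinely certified**: along its grid chain (`k ↦ cterm (grid k)` at the slopes `th (grid k)`), `ShiftThree.phi_le` is the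
column-wise certificate of `chain_le_of_affineCert` with `S = 1`, `x a = (2r+5)·a`, `y = 0`. -/
theorem shiftThree_affineCert (r : ℕ) (k : Fin (ShiftThree.T r (r + 1) - 1 + 1)) (b a : Fin (r + 1)) (l : Fin 3)
    (h : ShiftThree.ee r a b l ≠ 0) :
    1 * (ShiftThree.th r (ShiftThree.grid r k).1 (ShiftThree.grid r k).2 * (ShiftThree.dd r l : ℤ) - ShiftThree.vv r a b l) +
        (ShiftThree.th r (ShiftThree.grid r k).1 (ShiftThree.grid r k).2 * ((2 * r + 5) * (a : ℤ)) - (0 : Fin (r + 1) → ℤ) a) ≤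
      1 * (ShiftThree.th r (ShiftThree.grid r k).1 (ShiftThree.grid r k).2 *
            (ShiftThree.dd r ((ShiftThree.cterm r (ShiftThree.grid r k).1 (ShiftThree.grid r k).2).2 b) : ℤ) -
          ShiftThree.vv r ((ShiftThree.cterm r (ShiftThree.grid r k).1 (ShiftThree.grid r k).2).1 b) b
            ((ShiftThree.cterm r (ShiftThree.grid r k).1 (ShiftThree.grid r k).2).2 b)) +
        (ShiftThree.th r (ShiftThree.grid r k).1 (ShiftThree.grid r k).2 *
            ((2 * r + 5) * (((ShiftThree.cterm r (ShiftThree.grid r k).1 (ShiftThree.grid r k).2).1 b : Fin (r + 1)) : ℤ)) -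
          (0 : Fin (r + 1) → ℤ) ((ShiftThree.cterm r (ShiftThree.grid r k).1 (ShiftThree.grid r k).2).1 b)) := by
  have hT1 : 1 ≤ ShiftThree.T r (r + 1) := by rw [ShiftThree.T_succ]; omega
  have hk : (k : ℕ) < ShiftThree.T r (r + 1) := by omega
  obtain ⟨h1, _⟩ := ShiftThree.grid_inv r k hk.le
  have hle := ShiftThree.phi_le r (ShiftThree.grid r k).1 (ShiftThree.grid r k).2 (ShiftThree.grid_fst_le r k hk) h1 a b l h
  rw [shiftThree_phi_eq, shiftThree_phi_eq] at hle
  unfold ShiftThree.cterm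
  simp only [Pi.zero_apply, sub_zero, one_mul]
  linarith

/-- **SHIFT-THREE inhabits the affine-dual sector**: the sector law applied to its certificate — `(C(r+3,2) − 2) + (r+1) ≤ 3·(r+1)²`
(the family's `T r (r+1) − 1` steps against the cap `K·m² − m` at `K = 3`, `m = r + 1`). -/
theorem shiftThree_chain_le (r : ℕ) : (ShiftThree.T r (r + 1) - 1) + (r + 1) ≤ 3 * (r + 1) ^ 2 := by
  have hT1 : 1 ≤ ShiftThree.T r (r + 1) := by rw [ShiftThree.T_succ]; omega
  refine chain_le_of_affineCert_alt (ShiftThree.dd r) (ShiftThree.vv r) (ShiftThree.ee r) 1 (fun a => (2 * r + 5) * (a : ℤ)) 0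
    (fun k => ShiftThree.th r (ShiftThree.grid r k).1 (ShiftThree.grid r k).2)
    (fun k => ShiftThree.cterm r (ShiftThree.grid r k).1 (ShiftThree.grid r k).2) one_pos ?_ ?_ ?_ ?_
  · refine Fin.strictMono_iff_lt_succ.mpr fun k => ?_
    simp only [Fin.val_castSucc, Fin.val_succ]
    exact ShiftThree.th_grid_lt r k (by omega)
  · intro k
    obtain ⟨h1, _⟩ := ShiftThree.grid_inv r k (by omega)
    exact ShiftThree.isDominant_cterm r _ _ (ShiftThree.grid_fst_le r k (by omega)) h1
  · intro k
    simp only [Fin.val_castSucc, Fin.val_succ]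
    rw [ShiftThree.termSign_grid r k (by omega), ShiftThree.termSign_grid r (k + 1) (by omega), ← pow_add,
      show (k : ℕ) + (k + 1) = 2 * k + 1 by ring, pow_succ, pow_mul]
    norm_num
  · intro k b a l h
    exact shiftThree_affineCert r k b a l h

end ShiftThreeInstance

end AffineDual

end Summit.ValiantsHypothesis.ValiantsHypothesis.Theorems.KPlusLogSqLaw
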